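import Literature.Computability.MetaComplexity.EFPlainMul
import HarnessLib

/-!
# Plain ripple-carry arithmetic: propagation of high zero bits, no carry-out of the multiplier

Layer P/4. "High zeros": a word `w` is `HZ(p)` if `wᵢ` is false for all `p ≤ i < L` (as lines).
* `Plain.HZ.isBlock_addLines` — if `x, y` are `HZ(P)` then the carries and sums of `x + y` are
  false above `P` (positions `≥ P + 1`), in particular the carry out of an `L`-bit adder is
  false when `P + 1 ≤ L`;
* `Plain.HZ.isBlock_maskLines` — a mask of a false multiplier bit, or of a high-zero word, is
  high-zero.
These facts discharge the "no overflow" hypotheses of the exponent laws (`mulLines` in the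
next file).

## Sources

* S. A. Cook, R. A. Reckhow, *The relative efficiency of propositional proof systems*,
  J. Symbolic Logic 44 (1979), §2.
-/

namespace Literature.Computability.MetaComplexity

open _root_.Computability Complexity Complexity.PropForm Netlist Cluster FregeSystem

namespace Plain

namespace HZ

/-- `[m ↔ g ∧ x, ¬x] ⊢ ¬m`. [cite: CookReckhow1979, §2 (sound rule)] -/
def rAndF2 : FregeRule := ⟨[ctx (var 0) (biimp (var 1) (conj (var 2) (var 3))), ctx (var 0) (neg (var 3))], ctx (var 0) (neg (var 1))⟩
/-- `[c' ↔ maj(x, y, c), ¬x, ¬y] ⊢ ¬c'`. [cite: CookReckhow1979, §2 (sound rule)] -/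
def rMajFF : FregeRule :=
  ⟨[ctx (var 0) (biimp (var 1) (majF (var 2) (var 3) (var 4))), ctx (var 0) (neg (var 2)), ctx (var 0) (neg (var 3))], ctx (var 0) (neg (var 1))⟩
/-- `[s ↔ xor3(x, y, c), ¬x, ¬y, ¬c] ⊢ ¬s`. [cite: CookReckhow1979, §2 (sound rule)] -/
def rXorFFF : FregeRule :=
  ⟨[ctx (var 0) (biimp (var 1) (xor3F (var 2) (var 3) (var 4))), ctx (var 0) (neg (var 2)), ctx (var 0) (neg (var 3)), ctx (var 0) (neg (var 4))],
    ctx (var 0) (neg (var 1))⟩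
/-- `[c' ↔ maj(x, y, c), ¬y, ¬c] ⊢ ¬c'`. [cite: CookReckhow1979, §2 (sound rule)] -/
def rMajF23 : FregeRule :=
  ⟨[ctx (var 0) (biimp (var 1) (majF (var 2) (var 3) (var 4))), ctx (var 0) (neg (var 3)), ctx (var 0) (neg (var 4))], ctx (var 0) (neg (var 1))⟩

/-- The rules of this layer. [cite: CookReckhow1979, §2] -/
def rules : List FregeRule := [rAndF2, rMajFF, rXorFFF, rMajF23]

/-- Every rule is sound. [cite: CookReckhow1979, §2 (sound rule)] -/
theorem isSound_of_mem_rules : ∀ r ∈ rules, r.IsSound := by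
  intro r hr
  simp only [rules, List.mem_cons, List.not_mem_nil, or_false] at hr
  rcases hr with rfl | rfl | rfl | rfl <;> exact FregeRule.isSound_of_check (by decide +kernel)

variable {G : FregeSystem} {K : PropForm ℕ} {Γ : Set (PropForm ℕ)} {L : ℕ}

/-- One-step inference by rule `i`. [folklore] -/
theorem infer (hG : ∀ r ∈ rules, r ∈ G.rules) (i : ℕ) (hi : i < rules.length) {S : Set (PropForm ℕ)}
    (σ : ℕ → PropForm ℕ) {φ : PropForm ℕ} (hφ : (rules[i]).conclusion.subst σ = φ)
    (hp : ∀ ψ ∈ (rules[i]).premises, ψ.subst σ ∈ S) : G.IsInferredFrom S φ :=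
  hφ ▸ FregeSystem.IsInferredFrom.of_rule (hG _ (List.getElem_mem hi)) σ rfl hp

/-! ### Adders -/

/-- The pair of high-zero lines at position `P + 1 + n`: `¬s`, then `¬c` of the next position. [folklore] -/
def addPair (S : Adder.View) (K : PropForm ℕ) (P n : ℕ) : List (PropForm ℕ) :=
  [ctx K (neg (var (S.s (P + 1 + n)))), ctx K (neg (var (S.c (P + 1 + n + 1))))]

/-- The high-zero lines of an adder above `P`: `¬c_{P+1}`, then for `n < L - 1 - P` the pairs
`¬s_{P+1+n}`, `¬c_{P+2+n}`. [folklore] -/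
def addLines (S : Adder.View) (K : PropForm ℕ) (P L : ℕ) : List (PropForm ℕ) :=
  [ctx K (neg (var (S.c (P + 1))))] ++ ((List.range (L - 1 - P)).map (addPair S K P)).flatten

/-- The prefix of `n` pairs. [folklore] -/
def addUpTo (S : Adder.View) (K : PropForm ℕ) (P n : ℕ) : List (PropForm ℕ) := ((List.range n).map (addPair S K P)).flatten

/-- `addUpTo` unfolds. [folklore] -/
theorem addUpTo_succ (S : Adder.View) (K : PropForm ℕ) (P n : ℕ) : addUpTo S K P (n + 1) = addUpTo S K P n ++ addPair S K P n := by
  simp [addUpTo, List.range_succ]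

/-- The last carry line of a prefix. [folklore] -/
theorem mem_addUpTo_c {S : Adder.View} {P n m : ℕ} (hm : m < n) : ctx K (neg (var (S.c (P + 1 + m + 1)))) ∈ addUpTo S K P n :=
  List.mem_flatten.2 ⟨_, List.mem_map.2 ⟨m, List.mem_range.2 hm, rfl⟩, by simp [addPair]⟩

/-- The sum line of a prefix. [folklore] -/
theorem mem_addUpTo_s {S : Adder.View} {P n m : ℕ} (hm : m < n) : ctx K (neg (var (S.s (P + 1 + m)))) ∈ addUpTo S K P n :=
  List.mem_flatten.2 ⟨_, List.mem_map.2 ⟨m, List.mem_range.2 hm, rfl⟩, by simp [addPair]⟩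

/-- **High zeros propagate through an adder**: if `xᵢ, yᵢ` are false for `P ≤ i < L` and the
adder of width `L` is available (any carry-in), then `¬c_i` for `P + 1 ≤ i ≤ L` and `¬s_i` for
`P + 1 ≤ i < L`. [cite: CookReckhow1979, §2] -/
theorem isBlock_addLines (hG : ∀ r ∈ rules, r ∈ G.rules) {S : Adder.View} {c₀ : Bool} (hS : S.Avail K Γ c₀ L) {P : ℕ} (hP : P < L)
    (hx : ∀ i, P ≤ i → i < L → ctx K (neg (var (S.x i))) ∈ Γ) (hy : ∀ i, P ≤ i → i < L → ctx K (neg (var (S.y i))) ∈ Γ) :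
    G.IsBlock Γ (addLines S K P L) := by
  have h0 : G.IsBlock Γ [ctx K (neg (var (S.c (P + 1))))] :=
    FregeSystem.IsBlock.singleton (Or.inr (infer hG 1 (by decide) (FregeSystem.sub [K, var (S.c (P + 1)), var (S.x P), var (S.y P), var (S.c P)]) rfl
      (FregeSystem.prems_cons (hS.2 P hP).2 (FregeSystem.prems_cons (hx P le_rfl hP) (FregeSystem.prems_cons (hy P le_rfl hP) FregeSystem.prems_nil)))))
  refine h0.append ?_
  show G.IsBlock _ (addUpTo S K P (L - 1 - P))
  suffices H : ∀ n ≤ L - 1 - P, G.IsBlock (Γ ∪ {χ | χ ∈ [ctx K (neg (var (S.c (P + 1))))]}) (addUpTo S K P n) from H _ le_rfl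
  intro n hn
  induction n with
  | zero => exact FregeSystem.IsBlock.nil _ _
  | succ n ih =>
    have hi : P + 1 + n < L := by omega
    -- the carry into position `P + 1 + n` is false: the first line, or the previous pair
    have hc : ctx K (neg (var (S.c (P + 1 + n)))) ∈ Γ ∪ {χ | χ ∈ [ctx K (neg (var (S.c (P + 1))))]} ∪ {χ | χ ∈ addUpTo S K P n} := by
      rcases Nat.eq_zero_or_pos n with rfl | hn0
      · exact Or.inl (Or.inr (List.mem_singleton_self _))
      · obtain ⟨m, rfl⟩ : ∃ m, n = m + 1 := ⟨n - 1, by omega⟩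
        exact Or.inr (mem_addUpTo_c (Nat.lt_succ_self m))
    rw [addUpTo_succ]
    refine (ih (by omega)).append ?_
    have s1 : ∀ {A B : Set (PropForm ℕ)}, A ⊆ A ∪ B := fun {_ _} => Set.subset_union_left
    refine (FregeSystem.IsBlock.singleton (Or.inr (infer hG 2 (by decide)
      (FregeSystem.sub [K, var (S.s (P + 1 + n)), var (S.x (P + 1 + n)), var (S.y (P + 1 + n)), var (S.c (P + 1 + n))]) rfl
      (FregeSystem.prems_cons (s1 (s1 (hS.2 _ hi).1)) (FregeSystem.prems_cons (s1 (s1 (hx _ (by omega) hi))) (FregeSystem.prems_cons (s1 (s1 (hy _ (by omega) hi)))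
        (FregeSystem.prems_cons hc FregeSystem.prems_nil))))))).append (FregeSystem.IsBlock.singleton (Or.inr ?_))
    exact infer hG 1 (by decide) (FregeSystem.sub [K, var (S.c (P + 1 + n + 1)), var (S.x (P + 1 + n)), var (S.y (P + 1 + n)), var (S.c (P + 1 + n))]) rfl
      (FregeSystem.prems_cons (s1 (s1 (s1 (hS.2 _ hi).2))) (FregeSystem.prems_cons (s1 (s1 (s1 (hx _ (by omega) hi))))
        (FregeSystem.prems_cons (s1 (s1 (s1 (hy _ (by omega) hi)))) FregeSystem.prems_nil)))

/-- The conclusions: `¬c_i` for `P + 1 ≤ i ≤ L` and `¬s_i` for `P + 1 ≤ i < L`. [folklore] -/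
theorem mem_addLines {S : Adder.View} {P i : ℕ} :
    (P + 1 ≤ i → i ≤ L → ctx K (neg (var (S.c i))) ∈ addLines S K P L) ∧ (P + 1 ≤ i → i < L → ctx K (neg (var (S.s i))) ∈ addLines S K P L) := by
  constructor
  · intro h1 h2
    rcases Nat.eq_or_lt_of_le h1 with rfl | hlt
    · exact List.mem_append_left _ (List.mem_singleton_self _)
    · have := mem_addUpTo_c (K := K) (S := S) (P := P) (n := L - 1 - P) (m := i - P - 2) (by omega)
      rw [show P + 1 + (i - P - 2) + 1 = i by omega] at this
      exact List.mem_append_right _ this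
  · intro h1 h2
    have := mem_addUpTo_s (K := K) (S := S) (P := P) (n := L - 1 - P) (m := i - P - 1) (by omega)
    rw [show P + 1 + (i - P - 1) = i by omega] at this
    exact List.mem_append_right _ this

/-- Size of the adder block. [folklore] -/
theorem proofSize_addLines (S : Adder.View) (K : PropForm ℕ) (P L : ℕ) : proofSize (addLines S K P L) ≤ (2 * L + 1) * (K.size + 4) := by
  have hl : (addLines S K P L).length ≤ 2 * L + 1 := by
    simp only [addLines, List.length_append, List.length_singleton, List.length_flatten, List.map_map]
    rw [show (List.map (List.length ∘ addPair S K P) (List.range (L - 1 - P))) = (List.range (L - 1 - P)).map (fun _ => 2) from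
      List.map_congr_left fun n _ => by simp [addPair]]
    simp [List.sum_replicate]; omega
  refine (ModAddU.Bounded.proofSize_le (B := K.size + 4) fun θ hθ => ?_).trans (Nat.mul_le_mul_right _ hl)
  simp only [addLines, List.mem_append, List.mem_singleton, List.mem_flatten, List.mem_map, List.mem_range] at hθ
  rcases hθ with rfl | ⟨l, ⟨n, -, rfl⟩, hθ⟩
  · simp [ctx, size]
  · simp only [addPair, List.mem_cons, List.not_mem_nil, or_false] at hθ
    rcases hθ with rfl | rfl <;> simp [ctx, size]

/-! ### Masks -/

/-- The false-mask lines of stage `t` from position `P` on. [folklore] -/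
def maskLines (L : ℕ) (o : Occ) (K : PropForm ℕ) (t P : ℕ) : List (PropForm ℕ) :=
  (List.range (L - P)).map fun n => ctx K (neg (var (Mul.msk L o t (P + n))))

/-- **False masks**: if `b_t` is false, or `(a << t)ⱼ` is false for `P ≤ j < L`, then
`mask_t` is `HZ(P)`. [cite: CookReckhow1979, §2] -/
theorem isBlock_maskLines (hG : ∀ r ∈ rules, r ∈ G.rules) (hGL : ∀ r ∈ Logic.rules, r ∈ G.rules) {o : Occ} (h : Mul.PAvail L o K Γ)
    {t P : ℕ} (ht : t < L) (hz : ctx K (neg (var (Mul.bin L o t))) ∈ Γ ∨ ∀ j, P ≤ j → j < L → ctx K (neg (var (Mul.ash L o t j))) ∈ Γ) :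
    G.IsBlock Γ (maskLines L o K t P) :=
  Scaffold.isBlock_of_forall fun θ hθ => by
    obtain ⟨n, hn, rfl⟩ := List.mem_map.1 hθ
    rw [List.mem_range] at hn
    rcases hz with hz | hz
    · exact Or.inr (Logic.infer hGL 16 (by decide) (FregeSystem.sub [K, var (Mul.msk L o t (P + n)), var (Mul.bin L o t), var (Mul.ash L o t (P + n))]) rfl
        (FregeSystem.prems_cons (h.1 t ht _ (by omega)) (FregeSystem.prems_cons hz FregeSystem.prems_nil)))
    · exact Or.inr (infer hG 0 (by decide) (FregeSystem.sub [K, var (Mul.msk L o t (P + n)), var (Mul.bin L o t), var (Mul.ash L o t (P + n))]) rfl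
        (FregeSystem.prems_cons (h.1 t ht _ (by omega)) (FregeSystem.prems_cons (hz _ (by omega) (by omega)) FregeSystem.prems_nil)))

/-- The conclusions of the false-mask lines. [folklore] -/
theorem mem_maskLines {o : Occ} {t P j : ℕ} (hP : P ≤ j) (hj : j < L) : ctx K (neg (var (Mul.msk L o t j))) ∈ maskLines L o K t P := by
  refine List.mem_map.2 ⟨j - P, List.mem_range.2 (by omega), ?_⟩
  rw [show P + (j - P) = j by omega]

/-- Size of the false-mask lines. [folklore] -/
theorem proofSize_maskLines (L : ℕ) (o : Occ) (K : PropForm ℕ) (t P : ℕ) : proofSize (maskLines L o K t P) ≤ L * (K.size + 4) :=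
  (proofSize_map_range_le (s := K.size + 4) fun n _ => by simp [ctx, size]).trans (Nat.mul_le_mul_right _ (Nat.sub_le L P))

/-! ### The multiplier: no carry-out, high zeros of the partial sums -/

section MulDefs

variable (L : ℕ) (o : Occ) (K : PropForm ℕ) (p q : ℕ)

/-- The lines of stage `t`: below `q` the masks are high-zero from `p + t` and the adder
propagates; from `q` on the masks are zero, the adder adds zero, and the high zeros of `R_t`
transfer to `R_{t+1}`. [folklore] -/
def stageLines (t : ℕ) : List (PropForm ℕ) :=
  if t < q then maskLines L o K t (p + t) ++ addLines (Mul.ADD L o t) K (p + t) L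
  else maskLines L o K t 0 ++ ((zaddLines (Mul.ADD L o t) K L ++ zaddSplit (Mul.ADD L o t) K L) ++
    (ModAddU.MFI.symmLines K (fun i => Mul.Rw L o (t + 1) (p + q + i)) (fun i => Mul.Rw L o t (p + q + i)) (L - (p + q)) ++
     (List.range (L - (p + q))).map fun i => ctx K (neg (var (Mul.Rw L o (t + 1) (p + q + i))))))

/-- The lines of the stages below `t`. [folklore] -/
def mulUpTo : ℕ → List (PropForm ℕ)
  | 0 => []
  | t + 1 => mulUpTo t ++ stageLines L o K p q t

/-- **The high-zero lines of the multiplier.** [folklore] -/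
def mulLines : List (PropForm ℕ) := mulUpTo L o K p q L

end MulDefs

variable {o : Occ} {p q : ℕ}

/-- `R_0` is the zero gate; `R_{t+1}` is the sum of stage `t`. [folklore] -/
theorem Rw_facts (t j : ℕ) : Mul.Rw L o 0 j = o.inp (2 * L) ∧ Mul.Rw L o (t + 1) j = (Mul.ADD L o t).s j :=
  ⟨by unfold Mul.Rw; rw [if_pos rfl], (Mul.s_ADD t j).symm⟩

/-- The conclusions of a stage below `q`: `¬c_L` and `R_{t+1}` is `HZ(p + t + 1)`. [folklore] -/
theorem mem_stage_lt {t : ℕ} (ht : t < q) (hpt : p + t < L) :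
    ctx K (neg (var ((Mul.ADD L o t).c L))) ∈ stageLines L o K p q t ∧
    ∀ i, p + t + 1 ≤ i → i < L → ctx K (neg (var (Mul.Rw L o (t + 1) i))) ∈ stageLines L o K p q t := by
  unfold stageLines; rw [if_pos ht]
  refine ⟨List.mem_append_right _ (mem_addLines.1 (by omega) le_rfl), fun i h1 h2 => ?_⟩
  rw [(Rw_facts (L := L) (o := o) t i).2]
  exact List.mem_append_right _ (mem_addLines.2 h1 h2)

/-- The conclusions of a stage from `q` on: `¬c_L`, `R_{t+1} ≡ R_t`, and `R_{t+1}` is `HZ(p + q)`. [folklore] -/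
theorem mem_stage_ge {t : ℕ} (ht : q ≤ t) (hL : 0 < L) :
    ctx K (neg (var ((Mul.ADD L o t).c L))) ∈ stageLines L o K p q t ∧
    (∀ i < L, ctx K (eqv (Mul.Rw L o (t + 1) i) (Mul.Rw L o t i)) ∈ stageLines L o K p q t) ∧
    ∀ i, p + q ≤ i → i < L → ctx K (neg (var (Mul.Rw L o (t + 1) i))) ∈ stageLines L o K p q t := by
  unfold stageLines; rw [if_neg (by omega)]
  refine ⟨?_, fun i hi => ?_, fun i h1 h2 => ?_⟩
  · have := (mem_zaddSplit (K := K) (S := Mul.ADD L o t) (W := L) (i := L - 1) (by omega)).2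
    rw [show L - 1 + 1 = L by omega] at this
    exact List.mem_append_right _ (List.mem_append_left _ this)
  · have := (mem_zaddSplit (K := K) (S := Mul.ADD L o t) (W := L) (i := i) hi).1
    rw [Mul.s_ADD] at this
    exact List.mem_append_right _ (List.mem_append_left _ this)
  · refine List.mem_append_right _ (List.mem_append_right _ (List.mem_append_right _ (List.mem_map.2 ⟨i - (p + q), List.mem_range.2 (by omega), ?_⟩)))
    rw [show p + q + (i - (p + q)) = i by omega]

/-- Earlier stages are contained in later prefixes. [folklore] -/
theorem mulUpTo_sub {t t' : ℕ} (h : t < t') : ∀ χ ∈ stageLines L o K p q t, χ ∈ mulUpTo L o K p q t' := by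
  intro χ hχ
  induction h with
  | refl => exact List.mem_append_right _ hχ
  | step _ ih => exact List.mem_append_left _ ih

/-- **The multiplier block**: with `a` in `HZ(p)` (`0 < p`), `b` in `HZ(q)`, `p + q ≤ L` and the
zero gate false (from `q` on either `b_t` is false or the shifted word is bitwise false), the
lines up to stage `t ≤ L` form a block; after it, `R_t` is `HZ(p + min t q)`. [cite: CookReckhow1979, §2] -/
theorem isBlock_mulUpTo (hG : ∀ r ∈ rules, r ∈ G.rules) (hGP : ∀ r ∈ Plain.rules, r ∈ G.rules) (hGX : ∀ r ∈ splitRules, r ∈ G.rules)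
    (hGL : ∀ r ∈ Logic.rules, r ∈ G.rules) (h : Mul.PAvail L o K Γ) (hpq : p + q ≤ L)
    (ha : ∀ i, p ≤ i → i < L → ctx K (neg (var (o.inp i))) ∈ Γ)
    (hb : ∀ t, q ≤ t → t < L → ctx K (neg (var (Mul.bin L o t))) ∈ Γ ∨ ∀ j < L, ctx K (neg (var (Mul.ash L o t j))) ∈ Γ)
    (hzz : ctx K (neg (var (o.inp (2 * L)))) ∈ Γ) :
    ∀ t ≤ L, G.IsBlock Γ (mulUpTo L o K p q t) ∧ ∀ i, p + min t q ≤ i → i < L → ctx K (neg (var (Mul.Rw L o t i))) ∈ Γ ∪ {χ | χ ∈ mulUpTo L o K p q t} := by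
  intro t ht
  induction t with
  | zero =>
    refine ⟨FregeSystem.IsBlock.nil _ _, fun i _ _ => ?_⟩
    rw [(Rw_facts (L := L) (o := o) 0 i).1]; exact Or.inl hzz
  | succ t ih =>
    obtain ⟨ihb, ihz⟩ := ih (by omega)
    have htL : t < L := by omega
    have s1 : ∀ {A B : Set (PropForm ℕ)}, A ⊆ A ∪ B := fun {_ _} => Set.subset_union_left
    have hav : Mul.PAvail L o K (Γ ∪ {χ | χ ∈ mulUpTo L o K p q t}) := h.mono s1
    -- the stage block
    have hst : G.IsBlock (Γ ∪ {χ | χ ∈ mulUpTo L o K p q t}) (stageLines L o K p q t) := by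
      unfold stageLines
      by_cases htq : t < q
      · rw [if_pos htq]
        have hm : G.IsBlock (Γ ∪ {χ | χ ∈ mulUpTo L o K p q t}) (maskLines L o K t (p + t)) :=
          isBlock_maskLines hG hGL hav htL (Or.inr fun j hj hjL => by
            unfold Mul.ash; rw [if_pos (by omega)]; exact Or.inl (ha _ (by omega) (by omega)))
        refine hm.append (isBlock_addLines hG ((hav.2 t htL).mono s1) (by omega) (fun i hi hiL => ?_) (fun i hi hiL => ?_))
        · exact s1 (ihz i (by rw [Nat.min_eq_left htq.le]; exact hi) hiL)
        · exact Or.inr (mem_maskLines hi hiL)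
      · rw [if_neg htq]
        have hm : G.IsBlock (Γ ∪ {χ | χ ∈ mulUpTo L o K p q t}) (maskLines L o K t 0) :=
          isBlock_maskLines hG hGL hav htL ((hb t (by omega) htL).imp Or.inl fun h' j _ hj => Or.inl (h' j hj))
        refine hm.append ((isBlock_zaddSplit hGP hGX ((hav.2 t htL).mono s1) fun i hi => Or.inr (mem_maskLines (Nat.zero_le _) hi)).append ?_)
        have hT := fun i (hi : i < L) => (mem_zaddSplit (K := K) (S := Mul.ADD L o t) (W := L) (i := i) hi).1
        refine (ModAddU.MFI.isBlock_symmLines hGL K fun i hi => ?_).append (Scaffold.isBlock_of_forall fun θ hθ => ?_)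
        · have := hT (p + q + i) (by omega)
          rw [Mul.s_ADD] at this; exact Or.inr this
        · obtain ⟨i, hi, rfl⟩ := List.mem_map.1 hθ
          rw [List.mem_range] at hi
          refine Or.inr (Logic.infer hGL 8 (by decide) (FregeSystem.sub [K, var (Mul.Rw L o t (p + q + i)), var (Mul.Rw L o (t + 1) (p + q + i))]) rfl
            (FregeSystem.prems_cons ?_ (FregeSystem.prems_cons (Or.inr (List.mem_map.2 ⟨i, List.mem_range.2 hi, rfl⟩)) FregeSystem.prems_nil)))
          exact Or.inl (Or.inl (Or.inl (ihz _ (by rw [Nat.min_eq_right (by omega)]; omega) (by omega))))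
    refine ⟨ihb.append hst, fun i hi hiL => ?_⟩
    -- the high zeros of `R_{t+1}`
    rw [mulUpTo]
    by_cases htq : t < q
    · have := (mem_stage_lt (L := L) (o := o) (K := K) (p := p) htq (by omega)).2 i (by
        rcases Nat.lt_or_ge (t + 1) q with h1 | h1
        · rw [Nat.min_eq_left h1.le] at hi; omega
        · rw [Nat.min_eq_right h1] at hi; omega) hiL
      exact Or.inr (List.mem_append_right _ this)
    · have := (mem_stage_ge (L := L) (o := o) (K := K) (p := p) (q := q) (t := t) (by omega) (by omega)).2.2 i
        (by rw [Nat.min_eq_right (by omega)] at hi; exact hi) hiL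
      exact Or.inr (List.mem_append_right _ this)

/-- **The multiplier has no carry-outs; `R_{t+1} ≡ R_t` from `q` on.** [cite: CookReckhow1979, §2] -/
theorem isBlock_mulLines (hG : ∀ r ∈ rules, r ∈ G.rules) (hGP : ∀ r ∈ Plain.rules, r ∈ G.rules) (hGX : ∀ r ∈ splitRules, r ∈ G.rules)
    (hGL : ∀ r ∈ Logic.rules, r ∈ G.rules) (h : Mul.PAvail L o K Γ) (hpq : p + q ≤ L)
    (ha : ∀ i, p ≤ i → i < L → ctx K (neg (var (o.inp i))) ∈ Γ)
    (hb : ∀ t, q ≤ t → t < L → ctx K (neg (var (Mul.bin L o t))) ∈ Γ ∨ ∀ j < L, ctx K (neg (var (Mul.ash L o t j))) ∈ Γ)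
    (hzz : ctx K (neg (var (o.inp (2 * L)))) ∈ Γ) : G.IsBlock Γ (mulLines L o K p q) :=
  (isBlock_mulUpTo hG hGP hGX hGL h hpq ha hb hzz L le_rfl).1

/-- The conclusions: no carry-out at any stage, and `R_{t+1} ≡ R_t` bitwise for `q ≤ t`. [folklore] -/
theorem mem_mulLines (hL : 0 < L) (hpq : p + q ≤ L) {t : ℕ} (ht : t < L) :
    ctx K (neg (var ((Mul.ADD L o t).c L))) ∈ mulLines L o K p q ∧
    (q ≤ t → ∀ i < L, ctx K (eqv (Mul.Rw L o (t + 1) i) (Mul.Rw L o t i)) ∈ mulLines L o K p q) := by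
  constructor
  · by_cases htq : t < q
    · exact mulUpTo_sub ht _ (mem_stage_lt (K := K) (o := o) htq (by omega)).1
    · exact mulUpTo_sub ht _ (mem_stage_ge (K := K) (o := o) (p := p) (Nat.le_of_not_lt htq) hL).1
  · intro hq i hi
    exact mulUpTo_sub ht _ ((mem_stage_ge (K := K) (o := o) (p := p) hq hL).2.1 i hi)

/-- The high zeros of the final word: `R_L` is `HZ(p + q)` (given the block's hypotheses, as
membership in `Γ ∪ lines`). [folklore] -/
theorem mem_mulLines_hz (hG : ∀ r ∈ rules, r ∈ G.rules) (hGP : ∀ r ∈ Plain.rules, r ∈ G.rules) (hGX : ∀ r ∈ splitRules, r ∈ G.rules)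
    (hGL : ∀ r ∈ Logic.rules, r ∈ G.rules) (h : Mul.PAvail L o K Γ) (hpq : p + q ≤ L)
    (ha : ∀ i, p ≤ i → i < L → ctx K (neg (var (o.inp i))) ∈ Γ)
    (hb : ∀ t, q ≤ t → t < L → ctx K (neg (var (Mul.bin L o t))) ∈ Γ ∨ ∀ j < L, ctx K (neg (var (Mul.ash L o t j))) ∈ Γ)
    (hzz : ctx K (neg (var (o.inp (2 * L)))) ∈ Γ) (hqL : q ≤ L) :
    ∀ i, p + q ≤ i → i < L → ctx K (neg (var (Mul.Rw L o L i))) ∈ Γ ∪ {χ | χ ∈ mulLines L o K p q} := by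
  have := (isBlock_mulUpTo (G := G) hG hGP hGX hGL h hpq ha hb hzz L le_rfl).2
  rw [Nat.min_eq_right hqL] at this; exact this

/-- Size of a stage. [folklore] -/
theorem proofSize_stageLines (L : ℕ) (o : Occ) (K : PropForm ℕ) (p q t : ℕ) : proofSize (stageLines L o K p q t) ≤ (9 * L + 2) * (K.size + 20) := by
  have hK := Nat.zero_le K.size
  have hm := fun P => proofSize_maskLines L o K t P
  unfold stageLines
  split_ifs
  · rw [proofSize_append]
    have h2 := proofSize_addLines (Mul.ADD L o t) K (p + t) L
    nlinarith [hm (p + t)]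
  · simp only [proofSize_append]
    have h2 := proofSize_zaddLines (Mul.ADD L o t) K L
    have h2b : proofSize (zaddSplit (Mul.ADD L o t) K L) ≤ 2 * L * (K.size + 10) := by
      rw [zaddSplit, proofSize_append]
      have a : proofSize ((List.range L).map fun i => ctx K (eqv ((Mul.ADD L o t).s i) ((Mul.ADD L o t).x i))) ≤ L * (K.size + 10) :=
        proofSize_map_range_le fun i _ => by simp [ctx, eqv, size, FregeSystem.size_biimp]
      have b : proofSize ((List.range L).map fun i => ctx K (neg (var ((Mul.ADD L o t).c (i + 1))))) ≤ L * (K.size + 10) :=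
        proofSize_map_range_le fun i _ => by simp [ctx, size]
      have e : L * (K.size + 10) + L * (K.size + 10) = 2 * L * (K.size + 10) := by ring
      omega
    have h3 : proofSize (ModAddU.MFI.symmLines K (fun i => Mul.Rw L o (t + 1) (p + q + i)) (fun i => Mul.Rw L o t (p + q + i)) (L - (p + q))) ≤ L * (K.size + 10) := by
      unfold ModAddU.MFI.symmLines
      exact (proofSize_map_range_le (s := K.size + 10) fun i _ => by simp [ctx, eqv, size, FregeSystem.size_biimp]).trans (Nat.mul_le_mul_right _ (Nat.sub_le _ _))
    have h4 : proofSize ((List.range (L - (p + q))).map fun i => ctx K (neg (var (Mul.Rw L o (t + 1) (p + q + i))))) ≤ L * (K.size + 4) :=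
      (proofSize_map_range_le (s := K.size + 4) fun i _ => by simp [ctx, size]).trans (Nat.mul_le_mul_right _ (Nat.sub_le _ _))
    have h1 := hm 0
    nlinarith

/-- **Size of the multiplier block**: `≤ L (9L + 2) (|K| + 20)`. [folklore] -/
theorem proofSize_mulLines (L : ℕ) (o : Occ) (K : PropForm ℕ) (p q : ℕ) : proofSize (mulLines L o K p q) ≤ L * ((9 * L + 2) * (K.size + 20)) := by
  have h : ∀ t, proofSize (mulUpTo L o K p q t) ≤ t * ((9 * L + 2) * (K.size + 20)) := by
    intro t
    induction t with
    | zero => simp [mulUpTo, proofSize]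
    | succ t ih => rw [mulUpTo, proofSize_append]; nlinarith [proofSize_stageLines L o K p q t]
  exact h L

end HZ

end Plain

end Literature.Computability.MetaComplexity
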